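import Summits.QuantumFields.BalabanUV.T4Continuum.Spine.NE1p.DressedSourceAnalyticOnCores
import Summits.QuantumFields.BalabanUV.T4Continuum.Spine.NE1p.DressedSmallFieldCoresMassWitness

/-!
# T⁴ programme, spine estimate NE1′ (node O3b/H2) — WITNESS «THE RESPONSE IS LIVE»: S33's source-analyticity END and its
# linear-response END for (2.14)-cores FIRE on W35's letter-budget activity `actM` along the SOURCE pencil `0 + s • liveTable`
# (row NE5's toy frame, pv22's torus), and the source DERIVATIVE of the dressed output is NOT identically zero on the window —
# the response bound is charged by a live quantity

Cell `pub-balaban`, sub-cell `t4`, BINDER-OWNERS row NE1′; NE1′ formalisation crew, unit `b2b-balaban-t4-ne1p-formalise-leaf-03`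
(LEAF PROVER 03, generation 12); crew row W⟨next⟩ of `t4/formal/NE1p/LEAVES.md` (follower of the unit's own S33 in its own scope).
ADDITIVE — imports S33 `Spine/NE1p/DressedSourceAnalyticOnCores` (p230131) and W35 `Spine/NE1p/DressedSmallFieldCoresMassWitness`
(p227597, leaf-09-g10: `cM`, `actM`, `hM3_mu`, `hsmall_mu`, `coresMuEnd_live`; → W33 `coreFam`∕`liveTable`∕`ctr0`∕`hroom0`∕`termsW`,
W24 `X₀`∕`hrate_torus`, N0o `torus_consts`, S24 `K₀_four`) ONLY; THEOREMS ONLY (0 def, 0 `def … : Prop`, 0 cite); nothing of S33 ∕ W35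
∕ W33 ∕ W24 ∕ N0n–N0r ∕ row NE5 is restated — their declarations are used BY NAME.

WHAT IT SHOWS.  (1) `analyticEnd_fires` — S33 §3 `analytic_and_bounded_locE_of_coresAt_pencil_mass` APPLIED ONCE BY NAME on W35's
decided datum (W33's core family at the letter-budget weight `cM`, NE5's toy letters `(mq, bq, N₀) = (1, 0, 1)` inline, the source pencil
`0 + s • liveTable` on `‖s‖ < μ₁`, `μ₁ ≤ 2`, class radii `1`∕`2`, `hM3_mu` with EQUALITY, `hsmall_mu`, `hrate_torus`): the dressed output
`s ↦ E[actM s](X₀)` is complex differentiable on the source disc and bounded there by `e·ν·c₁·K₀²·A·e⁰` (= `K₀(64,8)`,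
`analyticEnd_fires_closed`).  (2) `responseEnd_fires` — S33 §3 `muDeriv_locE_le_of_coresAt_pencil_mass` APPLIED ONCE BY NAME on the
same datum: `‖∂_s E[actM s](X₀)|_{sμ}‖ ≤ 2·(…)∕(μ₁ − μ₀)` for `‖sμ‖ ≤ μ₀ < μ₁` (= `2·K₀(64,8)∕(μ₁ − μ₀)`, `responseEnd_fires_closed`).
(3) GENUINE — `deriv_not_identically_zero`: for `0 < μ₀ < μ₁ ≤ 2` the source derivative does NOT vanish on the whole closed window
`‖s‖ ≤ μ₀`: otherwise `E` would be constant on the open disc `‖s‖ < μ₀` (`IsOpen.is_const_of_deriv_eq_zero` with (1)'s differentiability),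
contradicting W35's `coresMuEnd_live` at the real source `t = μ₀∕2` (`E(t) ≠ E(0)`); hence `∃ sμ, ‖sμ‖ ≤ μ₀ ∧ deriv E sμ ≠ 0` — the
quantity bounded in (2) is LIVE (`responseEnd_live`).  (4) `envelope_live`: the function bounded in (1) is not constant either.

HONEST FRAMING.  A decided toy over row NE5's frame at W35's CHOSEN weight: S33's two cores ENDs exercised in kernel and shown
non-vacuous; the derivative's non-vanishing is by the constancy theorem, NOT a closed-form derivative (none is claimed); nothing about
Bałaban's dressings or densities; (B1b) by definition of the toy activity; (B3) met because the weight is CHOSEN (`hM3_mu`, equality) —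
G-ne9p2-5 UNPRINTED for Bałaban's cores; `2`, `½`, `K₀ 64 8` are N0j's factor ∕ OUR toy arithmetic ∕ pv22's PROVED constant BY NAME — no
numeral of [Balaban1988RGII]; 0 binders instantiated on Bałaban's densities; no wall item; wall v1.7 (T4-DAG v43) does NOT move;
R-t4r2-Q2 NOT met.  NE1′ ⇐ the named binders — NOT proved, NOT printed; spine PROVED 0∕9; count 9 unchanged.  Rung (B)+1 on ONE finite
four-torus — NOT infinite volume, NOT a mass gap, NOT OS on ℝ⁴, NOT Clay.  HONEST DEPENDENCY: continuum YM on T⁴ ⇐ BetaPertH ∧ nine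
spine estimates (0/9 proved); BetaPertH ⇐ (D1) ∧ (D4) ∧ CAP+tail; G-an2-4 gates asym, D1 and NE2/3/4.
-/

noncomputable section

namespace Summit.QuantumFields.BalabanUV.T4Continuum.NE1p.DressedSourceAnalyticWitness

open Set Metric MeasureTheory Complex
open scoped BigOperators
open Literature.MathematicalPhysics.QuantumFieldTheory.Balaban1983to89
open Literature.MathematicalPhysics.QuantumFieldTheory.Balaban1983to89.B12TreeDecay (K₀ K₀_pos)
open Literature.MathematicalPhysics.QuantumFieldTheory.Balaban1983to89.B13Resummation (locE)
open Literature.MathematicalPhysics.QuantumFieldTheory.Balaban1983to89.TreeLengthTorus (TDom tsys)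
open Literature.MathematicalPhysics.QuantumFieldTheory.Balaban1983to89.TreeLengthTorusGeometry (tgeometry TTouch)
open Summit.QuantumFields.BalabanUV.T4Continuum.B13HistMeasurable (B13HistM)
open Summit.QuantumFields.BalabanUV.T4Continuum.B13HistWitness (toyFrame)
open Summit.QuantumFields.BalabanUV.T4Continuum.NE1p.DressedSmallFieldTorusWitness (X₀ hrate_torus)
open Summit.QuantumFields.BalabanUV.T4Continuum.NE1p.DressedSmallFieldGeometry (torus_consts)
open Summit.QuantumFields.BalabanUV.T4Continuum.NE1p.DressedSmallFieldGeometryFaces (K₀_four)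
open Summit.QuantumFields.BalabanUV.T4Continuum.NE1p.DressedSmallFieldCoresWitness (liveTable norm_liveTable_le coreFam ctr0 hroom0
  Acst Acst_pos termsW)
open Summit.QuantumFields.BalabanUV.T4Continuum.NE1p.DressedSmallFieldCoresMassWitness (cM actM hM3_mu hsmall_mu coresMuEnd_live)
open Summit.QuantumFields.BalabanUV.T4Continuum.NE1p.DressedSourceAnalyticOnCores (analytic_and_bounded_locE_of_coresAt_pencil_mass
  muDeriv_locE_le_of_coresAt_pencil_mass)

variable (N : ℕ) [NeZero N] (r : ℝ) (hr : 0 ≤ r)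

/-- The source pencil `0 + s • liveTable` has table radius `2` on `‖s‖ < μ₁`, `μ₁ ≤ 2` (W35's inequality, restated as a lemma for
the two END applications below). [folklore] -/
theorem hH_pencil {μ₁ : ℝ} (hμ₁ : μ₁ ≤ 2) (k : ℕ) :
    ‖(0 : B13HistM toyFrame) - (ctr0 k (fun _ => 0) ()).2‖ + μ₁ * ‖liveTable‖ ≤ (fun _ : ℕ => (2 : ℝ)) k := by
  show ‖(0 : B13HistM toyFrame) - 0‖ + μ₁ * ‖liveTable‖ ≤ 2
  rw [sub_zero, norm_zero, zero_add]
  calc μ₁ * ‖liveTable‖ ≤ 2 * 1 := mul_le_mul hμ₁ norm_liveTable_le (norm_nonneg _) (by norm_num)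
    _ = 2 := by norm_num

/-- **(B3) FOR THE SOURCE PENCIL AT RADIUS `μ₁ ≤ 2`** [decided toy]: S33's letter budget `hM3` reads the read-out growth at the table
radius `‖0‖ + μ₁‖liveTable‖` (≤ 2); it follows from W35's `hM3_mu` (growth read at `2`, EQUALITY at `X₀`) by monotonicity of `exp`,
the letter masses being nonnegative. [folklore] -/
theorem hM3_pencil {μ₁ : ℝ} (hμ₁ : μ₁ ≤ 2) (k : ℕ) (R : ℝ) :
    ∀ Z : (tsys 4 N).Dom, (tgeometry 4 N).cubes Z ⊆ (tgeometry 4 N).cubes (X₀ N) →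
      ∑ i ∈ termsW N Z, (coreFam (cM r) r hr k i k).lam.real univ *
          ((coreFam (cM r) r hr k i k).wB * (fun (_ : ℕ) (_ : Unit) (_ : ℕ) => (1 : ℝ)) k i k *
            Real.exp ((fun (_ : ℕ) (_ : Unit) (_ : ℕ) => (0 : ℝ)) k i k)) *
          (Real.pi / ((fun (_ : ℕ) (_ : Unit) (_ : ℕ) => (1 : ℝ)) k i k / 2)) ^
            (Module.finrank ℝ DressedSmallFieldCoresWitness.E1 / 2 : ℝ) *
        Real.exp ((coreFam (cM r) r hr k i k).N₁ * (‖(0 : B13HistM toyFrame)‖ + μ₁ * ‖liveTable‖)) ≤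
      Acst * Real.exp (-(R * (tsys 4 N).dj Z)) := by
  intro Z hZ
  refine le_trans (Finset.sum_le_sum fun i _ => ?_) (hM3_mu N r hr k R Z hZ)
  have hx : ‖(0 : B13HistM toyFrame)‖ + μ₁ * ‖liveTable‖ ≤ 2 := by
    rw [norm_zero, zero_add]
    calc μ₁ * ‖liveTable‖ ≤ 2 * 1 := mul_le_mul hμ₁ norm_liveTable_le (norm_nonneg _) (by norm_num)
      _ = 2 := by norm_num
  refine mul_le_mul_of_nonneg_left (Real.exp_le_exp.2 (mul_le_mul_of_nonneg_left hx (coreFam (cM r) r hr k i k).N₁_nonneg)) ?_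
  refine mul_nonneg (mul_nonneg measureReal_nonneg (mul_nonneg (mul_nonneg ?_ zero_le_one) (Real.exp_pos _).le))
    (Real.rpow_nonneg (div_nonneg Real.pi_pos.le (by norm_num)) _)
  exact (norm_nonneg _).trans ((coreFam (cM r) r hr k i k).norm_w_le ())

/-! ## §1 S33's SOURCE-ANALYTICITY END FIRES on W35's letter-budget activity -/

open Classical in
/-- **S33 §3 `analytic_and_bounded_locE_of_coresAt_pencil_mass` FIRES ON THE LIVE CORE** [decided toy]: W33's core family at W35's
weight `cM`, NE5's toy letters `(mq, bq, N₀) = (1, 0, 1)` INLINE in the literal binder shapes, W33's `hroom0`∕`ctr0`, the class radii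
`‖0 − 0‖ ≤ 1` and `‖0 − 0‖ + μ₁‖liveTable‖ ≤ 2` (`μ₁ ≤ 2`), `hscale`∕`hact` by `rfl`, W24's `hrate_torus`, W35's `hsmall_mu` and `hM3_mu`
(EQUALITY at `X₀`).  Conclusion LITERAL: holomorphy of `s ↦ E[actM s](X₀)` on `‖s‖ < μ₁` AND the (2.41) envelope there. [folklore] -/
theorem analyticEnd_fires {μ₁ : ℝ} (hμ₁ : μ₁ ≤ 2) (k : ℕ) :
    DifferentiableOn ℂ (fun s => locE (tgeometry 4 N).ι (tgeometry 4 N).cubes (actM N r hr k s) ((tgeometry 4 N).cubes (X₀ N)))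
        (ball (0 : ℂ) μ₁) ∧
      ∀ s ∈ ball (0 : ℂ) μ₁, ‖locE (tgeometry 4 N).ι (tgeometry 4 N).cubes (actM N r hr k s) ((tgeometry 4 N).cubes (X₀ N))‖ ≤
        Real.exp 1 * (tgeometry 4 N).ν * (tgeometry 4 N).c₁ * (tgeometry 4 N).K₀ ^ 2 * Acst *
          Real.exp (-(0 * (tsys 4 N).dj (X₀ N))) :=
  analytic_and_bounded_locE_of_coresAt_pencil_mass (tsys 4 N) (tgeometry 4 N) (coreFam (cM r) r hr)
    (W := Set.univ) (ctr := ctr0) (ROp := fun _ => 1) (RHist := fun _ => 2) (R' := fun _ => 2)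
    (mq := fun _ _ _ => 1) (bq := fun _ _ _ => 0) (N₀ := fun _ _ _ => 1)
    hroom0 (fun _ _ _ _ _ _ _ => one_pos)
    (fun _ _ _ _ _ _ _ => ⟨fun _ _ => aestronglyMeasurable_const, fun _ => differentiableOn_const _, fun _ _ _ => by
      show ‖(1 : ℂ)‖ ≤ 1; rw [norm_one]⟩)
    (fun _ _ _ _ _ _ _ => ⟨fun _ _ => (Complex.measurable_ofReal.comp (measurable_snd.norm.pow_const 2)).aestronglyMeasurable,
      fun _ _ => differentiableOn_const _, fun _ _ _ v => by
        show 1 * ‖v‖ ^ 2 - 0 ≤ (((‖v‖ ^ 2 : ℝ) : ℂ)).re; rw [Complex.ofReal_re]; simp⟩)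
    (g := fun _ => 0) (Set.mem_univ _) (U := ()) (o := 0) (h₀ := 0) (v := liveTable) (μ₁ := μ₁)
    (by show ‖(0 : ℂ) - 0‖ ≤ 1; simp) (hH_pencil hμ₁ k)
    (emb := fun _ => k) (fun _ => rfl) (terms := termsW N) (act := actM N r hr k) (fun _ _ _ => rfl)
    (A := Acst) (R := 2 * (tgeometry 4 N).κ₀ + 2) (r₁ := 0) (b₅ := 0) (X₀ := X₀ N)
    Acst_pos.le le_rfl (by norm_num) (hrate_torus N) (hsmall_mu N) (hM3_pencil N r hr hμ₁ k _)

open Classical in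
/-- … the envelope in CLOSED FORM: `‖E[actM s](X₀)‖ ≤ K₀(64,8)` on the source disc (pv22's constants BY NAME). [folklore] -/
theorem analyticEnd_fires_closed {μ₁ : ℝ} (hμ₁ : μ₁ ≤ 2) (k : ℕ) {s : ℂ} (hs : s ∈ ball (0 : ℂ) μ₁) :
    ‖locE (tgeometry 4 N).ι (tgeometry 4 N).cubes (actM N r hr k s) ((tgeometry 4 N).cubes (X₀ N))‖ ≤ K₀ 64 8 := by
  refine ((analyticEnd_fires N r hr hμ₁ k).2 s hs).trans (le_of_eq ?_)
  rw [(torus_consts N).1, (torus_consts N).2.2, K₀_four, zero_mul, neg_zero, Real.exp_zero, mul_one]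
  unfold Acst
  have hK := K₀_pos (64 : ℝ) 8
  have he := Real.exp_pos 1
  field_simp

/-! ## §2 S33's LINEAR-RESPONSE END FIRES on the same datum -/

open Classical in
/-- **S33 §3 `muDeriv_locE_le_of_coresAt_pencil_mass` FIRES ON THE LIVE CORE** [decided toy]: same data; for `μ₀ < μ₁ ≤ 2` and
`‖sμ‖ ≤ μ₀`, `‖∂_s E[actM s](X₀)|_{sμ}‖ ≤ 2·(e·ν·c₁·K₀²·A·e⁰)∕(μ₁ − μ₀)`.  Conclusion LITERAL. [folklore] -/
theorem responseEnd_fires {μ₁ μ₀ : ℝ} {sμ : ℂ} (hμ₁ : μ₁ ≤ 2) (h01 : μ₀ < μ₁) (hμ : ‖sμ‖ ≤ μ₀) (k : ℕ) :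
    ‖deriv (fun s => locE (tgeometry 4 N).ι (tgeometry 4 N).cubes (actM N r hr k s) ((tgeometry 4 N).cubes (X₀ N))) sμ‖ ≤
      2 * (Real.exp 1 * (tgeometry 4 N).ν * (tgeometry 4 N).c₁ * (tgeometry 4 N).K₀ ^ 2 * Acst *
        Real.exp (-(0 * (tsys 4 N).dj (X₀ N)))) / (μ₁ - μ₀) :=
  muDeriv_locE_le_of_coresAt_pencil_mass (tsys 4 N) (tgeometry 4 N) (coreFam (cM r) r hr)
    (W := Set.univ) (ctr := ctr0) (ROp := fun _ => 1) (RHist := fun _ => 2) (R' := fun _ => 2)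
    (mq := fun _ _ _ => 1) (bq := fun _ _ _ => 0) (N₀ := fun _ _ _ => 1)
    hroom0 (fun _ _ _ _ _ _ _ => one_pos)
    (fun _ _ _ _ _ _ _ => ⟨fun _ _ => aestronglyMeasurable_const, fun _ => differentiableOn_const _, fun _ _ _ => by
      show ‖(1 : ℂ)‖ ≤ 1; rw [norm_one]⟩)
    (fun _ _ _ _ _ _ _ => ⟨fun _ _ => (Complex.measurable_ofReal.comp (measurable_snd.norm.pow_const 2)).aestronglyMeasurable,
      fun _ _ => differentiableOn_const _, fun _ _ _ v => by
        show 1 * ‖v‖ ^ 2 - 0 ≤ (((‖v‖ ^ 2 : ℝ) : ℂ)).re; rw [Complex.ofReal_re]; simp⟩)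
    (g := fun _ => 0) (Set.mem_univ _) (U := ()) (o := 0) (h₀ := 0) (v := liveTable) (μ₁ := μ₁)
    (by show ‖(0 : ℂ) - 0‖ ≤ 1; simp) (hH_pencil hμ₁ k)
    (emb := fun _ => k) (fun _ => rfl) (terms := termsW N) (act := actM N r hr k) (fun _ _ _ => rfl)
    (A := Acst) (R := 2 * (tgeometry 4 N).κ₀ + 2) (r₁ := 0) (b₅ := 0) (X₀ := X₀ N) (sμ := sμ)
    Acst_pos.le le_rfl (by norm_num) (hrate_torus N) (hsmall_mu N) (hM3_pencil N r hr hμ₁ k _) h01 hμ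

open Classical in
/-- … the response in CLOSED FORM: `‖∂_s E[actM s](X₀)|_{sμ}‖ ≤ 2·K₀(64,8)∕(μ₁ − μ₀)`. [folklore] -/
theorem responseEnd_fires_closed {μ₁ μ₀ : ℝ} {sμ : ℂ} (hμ₁ : μ₁ ≤ 2) (h01 : μ₀ < μ₁) (hμ : ‖sμ‖ ≤ μ₀) (k : ℕ) :
    ‖deriv (fun s => locE (tgeometry 4 N).ι (tgeometry 4 N).cubes (actM N r hr k s) ((tgeometry 4 N).cubes (X₀ N))) sμ‖ ≤
      2 * K₀ 64 8 / (μ₁ - μ₀) := by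
  refine (responseEnd_fires N r hr hμ₁ h01 hμ k).trans (le_of_eq ?_)
  rw [(torus_consts N).1, (torus_consts N).2.2, K₀_four, zero_mul, neg_zero, Real.exp_zero, mul_one]
  unfold Acst
  have hK := K₀_pos (64 : ℝ) 8
  have he := Real.exp_pos 1
  field_simp

/-! ## §3 GENUINE: the source derivative is NOT identically zero — the response bound is charged by a live quantity -/

open Classical in
/-- **THE DRESSED OUTPUT IS NOT CONSTANT IN THE SOURCE** [decided toy]: for `0 < t < μ₁ ≤ 2` (real source) `E[actM t](X₀) ≠
E[actM 0](X₀)` — W35's `coresMuEnd_live` BY NAME; so the function whose holomorphy (1) asserts is not constant on the disc. -/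
theorem envelope_live (hr0 : 0 < r) {μ₁ t : ℝ} (ht : 0 < t) (htμ : t < μ₁) (hμ₁ : μ₁ ≤ 2) (k : ℕ) :
    locE (tgeometry 4 N).ι (tgeometry 4 N).cubes (actM N r hr k (t : ℂ)) ((tgeometry 4 N).cubes (X₀ N)) ≠
      locE (tgeometry 4 N).ι (tgeometry 4 N).cubes (actM N r hr k 0) ((tgeometry 4 N).cubes (X₀ N)) :=
  coresMuEnd_live N r hr hr0 ht (htμ.le.trans hμ₁) k

open Classical in
/-- **THE SOURCE DERIVATIVE DOES NOT VANISH IDENTICALLY ON THE WINDOW** [decided toy]: for `0 < μ₀ < μ₁ ≤ 2` it is FALSE that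
`∂_s E[actM s](X₀) = 0` for every `‖s‖ ≤ μ₀`.  Otherwise the derivative vanishes on the open disc `‖s‖ < μ₀`, where `E` is complex
differentiable by (1) (`analyticEnd_fires` at radius `μ₀`), so `E` is constant there (`IsOpen.is_const_of_deriv_eq_zero`, the disc being
preconnected) — contradicting `envelope_live` at the real source `t = μ₀∕2`.  No closed-form derivative is claimed. [folklore] -/
theorem deriv_not_identically_zero (hr0 : 0 < r) {μ₁ μ₀ : ℝ} (h0 : 0 < μ₀) (h01 : μ₀ < μ₁) (hμ₁ : μ₁ ≤ 2) (k : ℕ) :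
    ¬ ∀ sμ : ℂ, ‖sμ‖ ≤ μ₀ →
      deriv (fun s => locE (tgeometry 4 N).ι (tgeometry 4 N).cubes (actM N r hr k s) ((tgeometry 4 N).cubes (X₀ N))) sμ = 0 := by
  intro hzero
  have hμ₀2 : μ₀ ≤ 2 := (h01.le.trans hμ₁)
  have hdiff := (analyticEnd_fires N r hr hμ₀2 k).1
  have hconst := isOpen_ball.is_const_of_deriv_eq_zero (convex_ball (0 : ℂ) μ₀).isPreconnected hdiff
    (fun s hs => hzero s (le_of_lt (mem_ball_zero_iff.1 hs)))
    (x := ((μ₀ / 2 : ℝ) : ℂ)) (y := 0)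
    (mem_ball_zero_iff.2 (by rw [Complex.norm_real, Real.norm_eq_abs, abs_of_pos (half_pos h0)]; linarith))
    (mem_ball_self h0)
  exact envelope_live N r hr hr0 (half_pos h0) (by linarith) hμ₁ k hconst

open Classical in
/-- **THE RESPONSE END's BOUNDED QUANTITY IS LIVE** [decided toy]: there is a source `‖sμ‖ ≤ μ₀` in the window at which the derivative
bounded by `responseEnd_fires` is NOT zero (so the bound `2·K₀(64,8)∕(μ₁ − μ₀)` is charged by a non-zero quantity). [folklore] -/
theorem responseEnd_live (hr0 : 0 < r) {μ₁ μ₀ : ℝ} (h0 : 0 < μ₀) (h01 : μ₀ < μ₁) (hμ₁ : μ₁ ≤ 2) (k : ℕ) :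
    ∃ sμ : ℂ, ‖sμ‖ ≤ μ₀ ∧
      deriv (fun s => locE (tgeometry 4 N).ι (tgeometry 4 N).cubes (actM N r hr k s) ((tgeometry 4 N).cubes (X₀ N))) sμ ≠ 0 ∧
      ‖deriv (fun s => locE (tgeometry 4 N).ι (tgeometry 4 N).cubes (actM N r hr k s) ((tgeometry 4 N).cubes (X₀ N))) sμ‖ ≤
        2 * K₀ 64 8 / (μ₁ - μ₀) := by
  obtain ⟨sμ, hsμ, hne⟩ : ∃ sμ : ℂ, ‖sμ‖ ≤ μ₀ ∧
      deriv (fun s => locE (tgeometry 4 N).ι (tgeometry 4 N).cubes (actM N r hr k s) ((tgeometry 4 N).cubes (X₀ N))) sμ ≠ 0 := by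
    by_contra h
    exact deriv_not_identically_zero N r hr hr0 h0 h01 hμ₁ k fun sμ hsμ => not_not.1 fun hne => h ⟨sμ, hsμ, hne⟩
  exact ⟨sμ, hsμ, hne, responseEnd_fires_closed N r hr hμ₁ h01 hsμ k⟩

end Summit.QuantumFields.BalabanUV.T4Continuum.NE1p.DressedSourceAnalyticWitness

end
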